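import Mathlib
import HarnessLib
import HarnessLib.Audit
import Summits.Parity.Statement
import Literature.Barriers.Parity.SiegelZeroDichotomy
import Literature.NumberTheory.Sieve.HardyLittlewood

/-!
Route: SiegelSpectrumSplit

DORMANT since 2026-09-04T15:05:41Z (reconciler: no traction for 5 d (last activity statement-checked at 2026-08-30T14:02:24Z); parked, not closed — `ledger route dormant route-Parity-SiegelSpectrumSplit --off` to reactivate) — unstaffed, not closed; items shared with open routes are served there. `ledger route dormant <id> --off` reactivates.

# Route SiegelSpectrumSplit — GHL ⟸ bounded Siegel-zero quality ∧ both one-sided halves conditioned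
on it — Landau–Siegel content certified in BOTH halves

WORKSHOP RECORD (decomp-parity cell, generation 0, RESIDUAL MODE on the summit-strength residual
PairsToGHL/18380 family; HOME = run/shared/lean/pub/decomp-parity/). NODE OF RECORD for the GHL
conjunct = lens-5 «SiegelSpectrumSplit» (HOME/decomp-parity-lens-5/SiegelSpectrumSplit.lean sha256
c44a3f019fdc12b1411081360d744005500e203b5ec8f3173e98927b1baa8bef, rc 0, 0 sorry, axioms {propext,
Classical.choice, Quot.sound}); critic verdicts: crit-1 CLEARED node 2026-08-30T01:46:27Z
(HOME/STATUS.md l.26), CLEARED route package 01:48:50Z (l.33), SYNTHESIS 01:47:20Z (l.30); it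
supersedes the writer frame GA «OneSidedHalves»/DecompOneSidedSiegel (CLEARED 01:42:37Z l.24 with
amendment A1) on binder 3 (bare LowerGHL → Q-conditioned LowerGivenBoundedSiegel, kernel certificate
`strict_lower`). Census data: HOME/census/COSTUME-CENSUS-v1.md sha256
4afbbbc68c038369818dcc2bcc5990569ac50a4757d8938468c0838377ddd628 (rows WK7 halves, WK8 ¬USZ
necessary, RG0 residual blocker). Per-piece tags (critic l.26): Q = BoundedSiegelZeroQuality —
WEAKER (GHL ⟹ Q kernel mod MM2023 print: tree
`PairsToGHL.Negative.not_generalizedHardyLittlewood_of_unboundedSiegelZeros`; Q ⟹ GHL unknown, Q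
parity-inert), leaf IDEA-NEEDED (Landau–Siegel) + ATTACKABLE-rung (Zhang2022 skeleton routes
PrimeLevelFamEdge / ZDegreeToeplitzBand, cited not re-typed; lens-2 T_ω ladder) + INSTRUMENTABLE
(finite NoRealZeroUpTo conductor tables — data, NOT a rung); UQ = UpperGivenBoundedSiegel —
WEAKER-formal (GHL ⟹ UQ trivial) + STRICTNESS certificate `strict_upper : (UQ → UpperGHL) → Q`
(one-sided MM theorem, w = 2 at h = 2q), DECLARED-RESIDUAL(Q) = all parity-UPPER content, leaf
ATTACKABLE rung ladder (uniform pair upper constant 4 PROVED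
`Literature.NumberTheory.Sieve.TwinSieveFour.twinSieveUpperBound_four` → 7/2 → 3.2996 → 2 under EH)
+ BARRIER(SelbergParity) below 2; LQ = LowerGivenBoundedSiegel — WEAKER-formal + STRICTNESS
certificate `strict_lower : (LQ → LowerGHL) → Q₄` (Landau–Siegel at conductors 4 ∣ q; factor-0
family h = q/2), DECLARED-RESIDUAL(Q) = all parity-LOWER content, leaf IDEA-NEEDED +
BARRIER(PrimePairParity, FordMaynardPrimeSieves), rung TwinLowerDensity stmt-Parity-18377. No piece
COSTUME, no EQUIV layer; necessity 3/3 (Q mod print, UQ/LQ kernel). Filed by decomp-parity-writer-1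
(statements and glue VERBATIM from the CLEARED package).

decomp-parity (D-0178/D-0179) lens-5 node «SiegelSpectrumSplit», ROOT-CONJUNCT node on GHL (the BH
conjunct rides as the sibling
piece of `Parity ⟺ BH ∧ GHL`). Lens «finite range + asymptotic regime + bridge» on the one dial that
carries theorems: the quality η
of exceptional zeros of primitive real characters. It suffices to show X = Q ∧ UQ ∧ LQ: Q =
BoundedSiegelZeroQuality (the FINITE RANGE:
η bounded at all large conductors, literally ¬UnboundedSiegelZeros), UQ = UpperGivenBoundedSiegel (Q
→ the von Mangoldt sum of every
non-degenerate affine-linear system never exceeds β_∞·∏β_p by more than εN^d, full Green–Tao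
quantifier block), LQ =
LowerGivenBoundedSiegel (Q → it never falls short by more than εN^d). The ASYMPTOTIC REGIME η → ∞ is
emptied by the BRIDGE
Matomäki–Merikoski 2023 Thm 1.3, which refutes BOTH bare halves there (excess factor 2 at h = 2q;
deficit factor 0 at h = q/2, 4 ∣ q).
Lean: `(∃ η₀ : ℝ, ∃ q₀ : ℕ, ∀ (q : ℕ) [NeZero q] (χ : DirichletCharacter ℂ q) (η : ℝ), q₀ ≤ q →
Literature.Barriers.Parity.IsSiegelZero χ η → η < η₀) ∧ ((∃ η₀ : ℝ, ∃ q₀ : ℕ, ∀ (q : ℕ) [NeZero q]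
(χ : DirichletCharacter ℂ q) (η : ℝ), q₀ ≤ q → Literature.Barriers.Parity.IsSiegelZero χ η → η < η₀)
→ ∀ (d t L : ℕ), 1 ≤ d → 1 ≤ t → ∀ ε : ℝ, 0 < ε → ∃ N₀ : ℕ, ∀ N : ℕ, N₀ ≤ N → ∀ Ψ : Fin t →
Literature.NumberTheory.Sieve.AffLinForm d, Literature.NumberTheory.Sieve.IsNondegenerateSystem Ψ →
Literature.NumberTheory.Sieve.affLinSize Ψ N ≤ L → ∀ K : Set (Fin d → ℝ), Convex ℝ K → K ⊆
Literature.NumberTheory.Sieve.realBox d N → Literature.NumberTheory.Sieve.vonMangoldtSum Ψ K N -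
Literature.NumberTheory.Sieve.archFactor Ψ K * Literature.NumberTheory.Sieve.singularProduct Ψ ≤ ε *
(N : ℝ) ^ d) ∧ ((∃ η₀ : ℝ, ∃ q₀ : ℕ, ∀ (q : ℕ) [NeZero q] (χ : DirichletCharacter ℂ q) (η : ℝ), q₀ ≤
q → Literature.Barriers.Parity.IsSiegelZero χ η → η < η₀) → ∀ (d t L : ℕ), 1 ≤ d → 1 ≤ t → ∀ ε : ℝ,
0 < ε → ∃ N₀ : ℕ, ∀ N : ℕ, N₀ ≤ N → ∀ Ψ : Fin t → Literature.NumberTheory.Sieve.AffLinForm d,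
Literature.NumberTheory.Sieve.IsNondegenerateSystem Ψ → Literature.NumberTheory.Sieve.affLinSize Ψ N
≤ L → ∀ K : Set (Fin d → ℝ), Convex ℝ K → K ⊆ Literature.NumberTheory.Sieve.realBox d N →
Literature.NumberTheory.Sieve.archFactor Ψ K * Literature.NumberTheory.Sieve.singularProduct Ψ -
Literature.NumberTheory.Sieve.vonMangoldtSum Ψ K N ≤ ε * (N : ℝ) ^ d)`

## Assembly
Pure logic: from hQ : Q obtain the upper half (hUQ hQ) and the lower half (hLQ hQ); for given
d,t,L,ε take N₀ = max of the two thresholds and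
combine the two one-sided inequalities with `abs_sub_le_iff`. All three binders are consumed
(`closes` in glue.lean). The exact form
GHL ↔ Q ∧ UQ ∧ LQ holds modulo the vendored MM2023 fact (kernel `node_iff` in the HOME file).

Rationale: WHY THIS LINE. The sign split of GHL into one-sided halves is folklore; the new input is WHERE the
Landau–Siegel content sits. Matomäki–Merikoski 2023
Thm 1.3 (MatomakiMerikoski2023, vendored
`Literature.Barriers.Parity.MatomakiMerikoski2023_pairCorrelation`) computes, under an
exceptional zero of quality η → ∞ and conductor q, every pair sum Σ_{n ≤ q^V} Λ(n)Λ(n+h) with a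
correction factor w_q(h); w = 2 on the
family h = 2q refutes the UPPER half and w = 0 on the family h = q/2 (conductors 4 ∣ q; χ(n + q/2) =
−χ(n)) refutes the LOWER half — both
in kernel (HOME/decomp-parity-lens-5/SiegelSpectrumSplit.lean:
`not_upperGHL_of_unboundedSiegelZeros`,
`not_lowerGHL_of_unboundedSiegelZerosFour`, 0 sorry). Hence BOTH halves must be conditioned on Q to
be strictly weaker than themselves,
and the certificates `strict_upper : ((Q → U) → U) → Q`, `strict_lower : ((Q → L) → L) → Q₄`
(Landau–Siegel at conductors 4 ∣ q) make the
residuals' strictness a theorem. Imported area: multiplicative number theory of exceptional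
characters (HeathBrown1983PrimeTwins,
TaoTeravainen2021, MatomakiMerikoski2023, FriedlanderIwaniec2022). Versus the negatives index /
prior routes: every existing GHL
decomposition on the ledger is «pair bricks ∧ a summit-strength exchange-rate residual (stmt 18380 /
9389)»; this one has no
summit-strength piece and no EQUIV layer.

RANKED CRUXES. #2 BoundedSiegelZeroQuality (crux) — Siegel zeros of primitive quadratic characters
have bounded quality at all large conductors: ∃ η₀ q₀, every Siegel zero (IsSiegelZero χ η) of
conductor q ≥ q₀ has η < η₀ — literally ¬UnboundedSiegelZeros (Landau–Siegel in the form the MM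
bridge needs). [difficulty: open-problem] (why it might fail: it is the Landau–Siegel problem: no
unconditional bound on η is known (Siegel's theorem is ineffective); Zhang2022LandauSiegel claims
L(1,χ) ≫ (log D)^{-2022} but is unverified — a genuine open problem, not a lemma.)
[Zhang2022LandauSiegel, HeathBrown1983PrimeTwins, TaoTeravainen2021, MatomakiMerikoski2023,
FriedlanderIwaniec2022]
#3 UpperGivenBoundedSiegel (crux) — assuming bounded Siegel-zero quality, the UPPER half of
shift-uniform GHL: for all d, t, L, ε and N ≥ N₀(d,t,L,ε), every non-degenerate system Ψ with ‖Ψ‖_N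
≤ L and convex K ⊆ [−N,N]^d has Σ_{n ∈ K} ∏Λ(ψ_i(n)) − β_∞·∏β_p ≤ εN^d (DECLARED-RESIDUAL of the
upper half, conditioned on Q; strictness: a proof of (this → UpperGHL) is a proof of Q, kernel
strict_upper). [deps: BoundedSiegelZeroQuality] [difficulty: open-problem] (why it might fail: as a
TARGET it is the parity-even half of GHL with the Siegel obstruction removed: uniform upper
constants below 2 are blocked for Type-I sieves (Selberg), and even factor 1+o(1) for pairs is open
under GRH; it may simply be as hard as GHL given Q.) [Selberg1949, Bombieri1976,
BombieriFriedlanderIwaniecActa1986, Lichtman2025LinearSieve, GreenTao2010, FriedlanderIwaniec2022]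
#4 LowerGivenBoundedSiegel (crux) — assuming bounded Siegel-zero quality, the LOWER half of
shift-uniform GHL: same quantifier block, conclusion β_∞·∏β_p − Σ ≤ εN^d (DECLARED-RESIDUAL of the
lower half, conditioned on Q; STRICTLY weaker than the bare lower half: a proof of (this → LowerGHL)
proves Landau–Siegel at conductors 4 ∣ q, kernel strict_lower via the factor-0 family h = q/2).
[deps: BoundedSiegelZeroQuality] [difficulty: open-problem] (why it might fail: as a TARGET it
contains the twin prime conjecture with the right constant; every Type-I/II-information route to
positive pair lower bounds is blocked by parity (Selberg, Bombieri, Ford–Maynard) even given Q; no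
idea on file produces primes in pairs.) [GreenTao2010, Bombieri1976, FordMaynard2024,
FriedlanderIwaniec2022, HardyLittlewood1923]

TWO-LAYER PLAN. UQ ⇐ (Q → UpperPairsUniform) → (UpperPairs-to-systems transfer) → UQ is NOT foreseen
to be glued (the second factor would be an
exchange rate of the COSTUME class, census rows WK7/WK8); the foreseen children are RUNGS, not
splits: uniform pair upper constants
4 (PROVED, TwinSieveFour.twinSieveUpperBound_four) → 7/2 → 3.29956 → 2 (EH) under UQ;
TwinLowerDensity (stmt-Parity-18377) under LQ;
Zhang2022 Thm 1 (routes PrimeLevelFamEdge / ZDegreeToeplitzBand) under Q.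

KILL CRITERIA. A proof of UnboundedSiegelZeros refutes Q and (tree theorem, mod MM2023) GHL itself —
the route and the sub-problem close refuted together.
A proof that UQ → UpperGHL or LQ → LowerGHL WITHOUT proving a Landau–Siegel theorem would contradict
strict_upper / strict_lower (kernel) —
impossible; so the only pivots are: Q proved elsewhere (then UQ, LQ become the bare halves: re-file
as UpperGHL / LowerGHL), or a
refutation of GHL at bounded Siegel quality (kills LQ or UQ substantively: route closes refuted,
summit refuted).

NOT DECOMPOSED YET. The halves are not split by complexity, dimension or shift range (critic rules
T2/T3/T8: free-variable averaging and the finite-complexity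
theorem make such cells ≡ the half); constants ladders (4, 7/2, 3.29956, 2) are rungs filed on
existing routes, not items here; the second
factor-0 family (h = 4q/3 at 3 ‖ q) and the deficit families 1 − 1/(p₀ − 2) are not typed.

CHEAPEST FALSIFIER. The sign bookkeeping of the MM correction factor: w(2q) must be 2 (excess ⇒
upper violation) and w(q/2) must be 0 at 4 ∣ q (deficit ⇒ lower
violation). Both checked in kernel (mm_correction_two_mul from the tree; mm_correction_half new,
HOME file, lean check rc 0). Second
cheapest: that Q is not secretly implied by a tree theorem — `lean search` for
`¬UnboundedSiegelZeros` / `NoSiegelZeros` finds only the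
equivalence noSiegelZeros_iff_not_unboundedSiegelZeros and conditional statements, no proof.

NUMBERS. Uniform prime-pair upper constants (rungs under UQ): 4 (Selberg/β-sieve, PROVED in tree),
7/2 (Bombieri–Friedlander–Iwaniec level 4/7),
3.29956 (Lichtman2025LinearSieve), 2 (under Elliott–Halberstam; = the parity ceiling of Type-I
sieves). Siegel quality threshold in
IsSiegelZero: η ≥ 10; MM range used: N = q^{10}, shifts h ∈ {2q, q/2}, affLinSize ≤ 3.

DEFINITION REQUESTS. None: all pieces are stated over existing declarations (IsSiegelZero,
AffLinForm, vonMangoldtSum, archFactor, singularProduct, realBox).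

Novelty: Searches (2026-08-30): lean search 'UnboundedSiegelZeros' / 'NoSiegelZeros' / 'LowerGHL|one-sided'
(tree: two-sided refutation
PairsToGHL.Negative.not_generalizedHardyLittlewood_of_unboundedSiegelZeros only; no one-sided or
lower-sign statement); lit search --hybrid "exceptional zero prime pairs correlation correction
factor deficit" and "Siegel zero twin primes lower bound sign" (hits:
friedlander2022-exceptional-zeros-sieve-parity-goldbach pp.3–19, harman2007 pp.285–286,
montgomery2007 p.300, arxiv-2602.03626); ledger negatives --problem Parity (no Siegel-conditioned
statement refuted); bus: writer GA (upper-only placement), lens-4 ExceptionalWindows (halves at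
Siegel-free scales).
Nearest prior art found: MatomakiMerikoski2023 Thm 1.3 / Cor. (pair correlations under Siegel zeros
with the correction factor, both signs implicit in the formula); HeathBrown1983PrimeTwins (twin
primes from Siegel zeros); [corpus:paper:friedlander2022-exceptional-zeros-sieve-parity-goldbach
p.16] (FriedlanderIwaniec2022: parity barrier ↔ exceptional characters); on the hub: writer frame GA
«OneSidedHalves» (Q ∧ (Q → U) ∧ L) and lens-4 «ExceptionalWindows».
Delta: the first typed placement of the Landau–Siegel content of BOTH one-sided halves of
shift-uniform GHL — the lower half is not Siegel-inert (factor-0 family h = q/2 at 4 ∣ q, kernel) —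
giving the weakest Q-conditioned residuals with kernel strictness certificates (strict_upper,
strict_lower), versus GA's upper-only placement with a bare l  [refs: arxiv-2602.03626, paper:friedlander2022-exceptional-zeros-sieve-parity-goldbach, MatomakiMerikoski2023, FriedlanderIwaniec2022]

Barriers (technique_class: exceptional-blind-shift, rosser-iwaniec, elliott-halberstam): - technique_class: exceptional-blind-shift, rosser-iwaniec, elliott-halberstam
- CYCLE-2 ROOT CERTIFICATE = node of record (parity decomposition line tagged HONEST-NEGATIVE,
operator OPS 2026-08-30T11:58:43Z):
Summits/Parity/GeneralizedHardyLittlewood/Theorems/RootExistenceConservation.lean (+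
RootExistenceConservationDefs / Shapes / Patterns / Twins; p770904, p771263, p771746, p771768,
p772612; decomp-parity lens-6 g9, critic rows 87/87b; 0 sorry, std axioms), decl
ExistenceConservation.root_certificate — with W := TwinPoor (Σ_{n≤N} Λ(n)Λ(n+2) = o(N)): every root
split of Summit.Parity leaves ¬TwinPoor (⟺ ChebyshevIO(X 2) ⟹ twinSet.Infinite) in the W-refuting
complement of its W-vacuous pieces (root_conservation); on THIS route that complement is the lower
lane LQ 25150 / FixedLower 26863 (lowerGivenQ_refutes_twinPoor mod MatomakiMerikoski2023_fixedShift,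
fixedLower_refutes_twinPoor), while Q, the twin face of the upper lane and UniformLowerGivenFixed
are W-VACUOUS (record_root_locus); barrier tie BY NAME PrimePairParity_holds (method-class statement
on IsSieveTheoreticDeduction, not unprovability). RELATIVE certificate, zero distance, refutes no
piece; 19-door table and honest rider in that module docstring; full placement text continues below
and in the ledger payload.
- Literature.Barriers.Parity.SiegelZeroTwinPrimes: met by design — Q is the leaf; the dichotomy's
exceptional branch refutes both bare halves (kernel), which is exactly why they are conditioned on
Q.
- Liter

History (route lifecycle, newest last):
- 2026-08-30T11:04:53Z · rev 6: dropped stmt-Parity-32328 — writer housekeeping: drop stmt-Parity-32328 (accidental duplicate add with placeholder signature 'x', created 11:04:29Z by this seat while checking the CLI; not (planner-decomp-parity-writer-1-g5-0)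
- 2026-08-30T11:06:12Z · rev 7: informal re-worded for stmt-Parity-32337 (planner-decomp-parity-writer-1-g5-0)
- 2026-08-30T22:03:03Z · RESIDUAL declared: UpperGivenBoundedSiegel (stmt-Parity-25149) — summit-strength until shown otherwise: Transcription of the census-tribunal verdict of record into the D-0170 item schema (gate window 13, live 2026-08-30T21:3 (planner-decomp-parity-writer-1-g9-0)
- 2026-08-30T22:03:08Z · RESIDUAL declared: LowerGivenBoundedSiegel (stmt-Parity-25150) — summit-strength until shown otherwise: Transcription of the census-tribunal verdict of record into the D-0170 item schema (gate window 13, live 2026-08-30T21:3 (planner-decomp-parity-writer-1-g9-0)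
- 2026-09-04T15:05:41Z · DORMANT — reconciler: no traction for 5 d (last activity statement-checked at 2026-08-30T14:02:24Z); parked, not closed — `ledger route dormant route-Parity-SiegelSpectru (operator:999:2068132)

sub-problem: GeneralizedHardyLittlewood · status: dormant · opened planner-decomp-parity-writer-1-g0-0 2026-08-30T02:22:53Z · rev 10 · ledger route-Parity-SiegelSpectrumSplit
GENERATED by the gate from the ledger (D-0016/17). Provers cite these decls: `theorem foo : Summit.Parity.GeneralizedHardyLittlewood.Theses.SiegelSpectrumSplit.<Decl> := …` in Summits/Parity/GeneralizedHardyLittlewood/Theorems/<Name>.lean.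
-/

namespace Summit.Parity.GeneralizedHardyLittlewood.Theses.SiegelSpectrumSplit

open scoped BigOperators Topology Manifold Classical MeasureTheory ProbabilityTheory Matrix InnerProductSpace ComplexConjugate ContinuousMap
open Filter Set Function TopologicalSpace MeasureTheory

attribute [summit_statement] _root_.GeneralizedHardyLittlewood

/-- item stmt-Parity-25148 · crux · rank 2 · SPLIT (gen 1) into HighBandZeroFree, LowBandZeroFree + glue BoundedSiegelZeroQualityGlue · direct attempts still welcome (low priority) · by planner
why it might fail: it is the Landau–Siegel problem: no unconditional bound on η is known (Siegel's theorem is ineffective); Zhang2022LandauSiegel claims L(1,χ) ≫ (log D)^{-2022} but is unverified — a genuine open problem, not a lemma.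
sources: Zhang2022LandauSiegel, HeathBrown1983PrimeTwins, TaoTeravainen2021, MatomakiMerikoski2023, FriedlanderIwaniec2022
[crux] Siegel zeros of primitive quadratic characters have bounded quality at all large conductors:
∃ η₀ q₀, every Siegel zero (IsSiegelZero χ η) of conductor q ≥ q₀ has η < η₀ — literally
¬UnboundedSiegelZeros (Landau–Siegel in the form the MM bridge needs). [difficulty: open-problem] ‖
TAG [crit-1 CLEARED 2026-08-30T01:46:27Z, HOME/STATUS.md l.26]: WEAKER (kernel mod MM2023 print; Q ⟹
GHL unknown); leaf IDEA-NEEDED (Landau–Siegel) + ATTACKABLE-rung (Zhang2022 skeleton routes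
PrimeLevelFamEdge/ZDegreeToeplitzBand; lens-2 T_ω ladder) + INSTRUMENTABLE (finite conductor tables,
not a rung). BC3 birth skeleton: stub_weakGoldbach (WeakHLGoldbachConj ½, open) → stub_exclusion
(MM2023 Cor 1.2 Goldbach detector + |L'| ≪ log²q, provable-now) → Q. Census
HOME/census/COSTUME-CENSUS-v1.md sha256
4afbbbc68c038369818dcc2bcc5990569ac50a4757d8938468c0838377ddd628 row WK8. -/
@[route_item "route-Parity-SiegelSpectrumSplit"]
def BoundedSiegelZeroQuality : Prop :=
  ∃ η₀ : ℝ, ∃ q₀ : ℕ, ∀ (q : ℕ) [NeZero q] (χ : DirichletCharacter ℂ q) (η : ℝ), q₀ ≤ q → Literature.Barriers.Parity.IsSiegelZero χ η → η < η₀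

-- parent: BoundedSiegelZeroQuality · child (gen 1)
/--     item stmt-Parity-25906 · crux · leaf ATTACKABLE · rank 201 · open
    parent: BoundedSiegelZeroQuality · by planner
    why it might fail: it is Zhang's CLAIMED Theorem 2 (arXiv:2211.02515, unrefereed; the F-S3 adjudication routes have not closed): false iff real zeros of quality > (log D)^2024/c₂ recur at arbitrarily large conductors — no polylog zero-free region of any exponent is a theorem (MV Cor 11.12).
    sources: Zhang2022LandauSiegel, MontgomeryVaughan2007, TaoTeravainen2021, DavenportMNT1980
[crux] CHILD 1 of the GLUED SPLIT of the blocker leaf Q = BoundedSiegelZeroQuality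
(stmt-Parity-25148; decomp-parity gen 2, REFINES route-Parity-SiegelSpectrumSplit:stmt-Parity-25148
— lens-2 node «SiegelBandSplit», HOME/decomp-parity-lens-2/SiegelBandSplit.lean sha256
5ceeb14908cf96ef5c8b5c9efe6606ef15477975de6a5c312bd1dfa465748240). Piece H «the SPECIAL band is
empty»: there is an absolute c₂ > 0 such that for every real primitive character χ mod D ≥ 3, L(σ,χ)
≠ 0 for σ > 1 − c₂/(log D)^2024 — word for word Zhang's claimed Theorem 2 (=
`Literature.NumberTheory.LFunctions.Zhang2022.Skeleton.Theorem2` = `ZeroFreeRegion 2024`, Iff.rfl: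
writer pkg2 `SplitQ.high_iff_theorem2`). ‖ TAG [crit-1 CLEARED 2026-08-30T02:22:43Z, HOME/STATUS.md
l.46]: WEAKER (kernel Q ⟹ H: `SplitQ.high_of_Q` / lens-2 `highBandZeroFree_of_boundedQuality`; H ⇏
Q: zeros of quality ≍ (log D)^k, 1 ≪ k < 2023, are H-consistent and make Q false); leaf ATTACKABLE =
exactly what the live Landau–Siegel routes deliver (registered rung F-S3
`Zhang2022.Skeleton.Theorem1` ⟹ H by the tree theorem `theorem2_of_theorem1`; routes
PrimeLevelFamEdge / ZDegreeToeplitzBand close F-S3; any effective L(1,χ) ≫ (log D)^{−B}, B ≤ 2022 ⟹ -/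
@[route_item "route-Parity-SiegelSpectrumSplit"]
def HighBandZeroFree : Prop :=
  ∃ c₂ : ℝ, 0 < c₂ ∧ ∀ (D : ℕ) [NeZero D] (χ : DirichletCharacter ℂ D), 3 ≤ D → χ.IsQuadratic → χ.IsPrimitive → ∀ σ : ℝ, 1 - c₂ / Real.log D ^ 2024 < σ → χ.LFunction σ ≠ 0

-- parent: BoundedSiegelZeroQuality · child (gen 1)
/--     item stmt-Parity-25907 · crux · leaf IDEA-NEEDED · rank 202 · open
    parent: BoundedSiegelZeroQuality · by planner
    why it might fail: it is the part of Landau–Siegel NO manuscript claims: false iff real zeros of quality between 1/c and (log D)^2024 recur at arbitrarily large conductors; Deuring–Heilbronn repulsion and mollified moments address the special band H, not this moderate band.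
    sources: TaoTeravainen2021, MontgomeryVaughan2007, Zhang2022LandauSiegel, LuZamanZhao2026, arxiv-2602.03626
[crux] CHILD 2 of the GLUED SPLIT of Q = BoundedSiegelZeroQuality (stmt-Parity-25148; REFINES
route-Parity-SiegelSpectrumSplit:stmt-Parity-25148 — lens-2 node «SiegelBandSplit»,
HOME/decomp-parity-lens-2/SiegelBandSplit.lean sha256
5ceeb14908cf96ef5c8b5c9efe6606ef15477975de6a5c312bd1dfa465748240). Piece L «the GENERIC band is
empty»: there are c > 0 and D₀ such that for every real primitive χ mod D ≥ D₀, L(σ,χ) ≠ 0 whenever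
1 − c/log D < σ ≤ 1 − (log D)^{−2025} — the classical region holds DOWN TO the polylog line
(moderate-quality Siegel zeros do not exist; the exponent 2025 = 2024 + 1 absorbs the unknown c₂ of
H). ‖ TAG [crit-1 CLEARED 2026-08-30T02:22:43Z, HOME/STATUS.md l.46]: WEAKER (kernel Q ⟹ L:
`SplitQ.low_of_Q` / lens-2 `lowBandZeroFree_of_boundedQuality`; L ⇏ Q: a world whose only real zeros
have super-polylog quality) and NOT COSTUME today (no polylog zero-free region of ANY exponent is a
theorem: unconditional ceilings are β₁ ≤ 1 − c/(q^{1/2} log² q) effective [corpus:montgomery2007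
p.283 Cor 11.12] and Siegel's q^{−ε} ineffective); leaf IDEA-NEEDED — L carries essentially ALL of
the Landau–Siegel difficulty (the moderate band has no arithmetic leverage: a zero at 1 − 1 -/
@[route_item "route-Parity-SiegelSpectrumSplit"]
def LowBandZeroFree : Prop :=
  ∃ c : ℝ, 0 < c ∧ ∃ D₀ : ℕ, ∀ (D : ℕ) [NeZero D] (χ : DirichletCharacter ℂ D), D₀ ≤ D → χ.IsQuadratic → χ.IsPrimitive → ∀ σ : ℝ, 1 - c / Real.log D < σ → σ ≤ 1 - 1 / Real.log D ^ 2025 → χ.LFunction σ ≠ 0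

-- parent: BoundedSiegelZeroQuality · glue (gen 1)
/--     item stmt-Parity-25908 · support · rank 203 · closed · proved by Summit.Parity.GeneralizedHardyLittlewood.Theses.SiegelSpectrumSplit.boundedSiegelZeroQualityGlue_holds (prover)
    parent: BoundedSiegelZeroQuality · GLUE: children ⟹ parent · by planner
H → L → Q (sufficiency of the band split; exactness Q ⟺ H ∧ L is kernel and unconditional): a
putative Siegel zero 1 − 1/(η log q) with η ≥ 1/c + 1 at a conductor q ≥ max(D₀, 3, ⌈e^{1/c₂}⌉) lies
right of the classical line 1 − c/log q, hence in the special band σ > 1 − c₂/(log q)^2024 (excluded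
by HighBandZeroFree) or in the generic band (excluded by LowBandZeroFree) — the bands overlap once
c₂ log q ≥ 1. KERNEL PROOF READY over the route decl: writer pkg2/SiegelBandGlue.lean `SplitQ.glue`
(= lens-2 `boundedQuality_of_bands`, HOME/decomp-parity-lens-2/SiegelBandSplit.lean sha256
5ceeb149…; lean check rc0, 0 sorry, axioms propext/Classical.choice/Quot.sound) — attached as
evidence; a prover ports it verbatim as Theorems/SiegelBandGlue.lean. [cite: TaoTeravainen2021 Def
1.4; DavenportMNT1980 Ch.14] -/
@[route_item "route-Parity-SiegelSpectrumSplit"]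
def BoundedSiegelZeroQualityGlue : Prop :=
  HighBandZeroFree → LowBandZeroFree → BoundedSiegelZeroQuality

-- `BoundedSiegelZeroQualityGlue` holds: proved by `Summit.Parity.GeneralizedHardyLittlewood.Theses.SiegelSpectrumSplit.boundedSiegelZeroQualityGlue_holds` (its module imports this route file, so no `_holds` link can be stated here).

/-- item stmt-Parity-25149 · crux · RESIDUAL (gen 0; summit-strength until shown otherwise, D-0170) · rank 3 · SPLIT (gen 1) into FixedUpper, UniformUpperGivenFixed + glue UpperGivenBoundedSiegelGlue · direct attempts still welcome (low priority) · by planner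
why it might fail: as a TARGET it is the parity-even half of GHL with the Siegel obstruction removed: uniform upper constants below 2 are blocked for Type-I sieves (Selberg), and even factor 1+o(1) for pairs is open under GRH; it may simply be as hard as GHL given Q.
sources: Selberg1949, Bombieri1976, BombieriFriedlanderIwaniecActa1986, Lichtman2025LinearSieve, GreenTao2010, FriedlanderIwaniec2022
[crux] assuming bounded Siegel-zero quality, the UPPER half of shift-uniform GHL: for all d, t, L, ε
and N ≥ N₀(d,t,L,ε), every non-degenerate system Ψ with ‖Ψ‖_N ≤ L and convex K ⊆ [−N,N]^d has Σ_{n ∈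
K} ∏Λ(ψ_i(n)) − β_∞·∏β_p ≤ εN^d (DECLARED-RESIDUAL of the upper half, conditioned on Q; strictness:
a proof of (this → UpperGHL) is a proof of Q, kernel strict_upper). [deps: BoundedSiegelZeroQuality]
[difficulty: open-problem] ‖ TAG [crit-1 CLEARED 2026-08-30T01:46:27Z, HOME/STATUS.md l.26]:
WEAKER-formal + DECLARED-RESIDUAL(Q) of the UPPER half (strictness certificate strict_upper); leaf
ATTACKABLE rung ladder 4 PROVED (TwinSieveFour.twinSieveUpperBound_four = BC5 witness) → 7/2 →
3.2996 → 2 (EH) + BARRIER(SelbergParity) below 2. BC3 birth skeleton: stub_upperDimOne (Q → upper d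
= 1 half, open) → stub_upperFibration (one-sided fibration d → 1, provable-now) → UQ. Census
HOME/census/COSTUME-CENSUS-v1.md sha256
4afbbbc68c038369818dcc2bcc5990569ac50a4757d8938468c0838377ddd628 row WK7. -/
@[route_item "route-Parity-SiegelSpectrumSplit"]
def UpperGivenBoundedSiegel : Prop :=
  (∃ η₀ : ℝ, ∃ q₀ : ℕ, ∀ (q : ℕ) [NeZero q] (χ : DirichletCharacter ℂ q) (η : ℝ), q₀ ≤ q → Literature.Barriers.Parity.IsSiegelZero χ η → η < η₀) → ∀ (d t L : ℕ), 1 ≤ d → 1 ≤ t → ∀ ε : ℝ, 0 < ε → ∃ N₀ : ℕ, ∀ N : ℕ, N₀ ≤ N → ∀ Ψ : Fin t → Literature.NumberTheory.Sieve.AffLinForm d, Literature.NumberTheory.Sieve.IsNondegenerateSystem Ψ → Literature.NumberTheory.Sieve.affLinSize Ψ N ≤ L → ∀ K : Set (Fin d → ℝ), Convex ℝ K → K ⊆ Literature.NumberTheory.Sieve.realBox d N → Literature.NumberTheory.Sieve.vonMangoldtSum Ψ K N - Literature.NumberTheory.Sieve.archFactor Ψ K * Literature.NumberTheory.Sieve.singularProduct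 Ψ ≤ ε * (N : ℝ) ^ d

-- parent: UpperGivenBoundedSiegel · child (gen 1)
/--     item stmt-Parity-26852 · crux · leaf BARRIER [Literature.Barriers.Parity.SelbergParityBarrier] · rank 301 · open
    parent: UpperGivenBoundedSiegel · by planner
    why it might fail: As a target it contains the upper prime k-tuples bound with constant 1+ε for every fixed tuple: Type-I sieves stop at factor 2 (Selberg parity, LinearSieveOptimality); record 3.3996 for twins; open even under GRH.
    sources: GreenTao2010, HardyLittlewood1923, Selberg1949, BombieriFriedlanderIwaniecActa1986, HeathBrown1983PrimeTwins, TaoTeravainen2022SiegelZero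
[crux; node TupleUniformitySplit (lens-5 g3, crit-1 CLEARED 2026-08-30T03:41:11Z STATUS l.116),
quantifier-order cut of UQ: the FIXED-PATTERN upper half] For every FIXED non-degenerate
affine-linear system Ψ (all d, t; quantifier order ∀Ψ ∃N₀, no size bound) and ε > 0, eventually in N
and uniformly in convex K ⊆ [−N,N]^d: Σ_{n∈K} ∏Λ(ψ_i(n)) − β_∞(Ψ,K)·∏β_p(Ψ) ≤ εN^d. OPEN CONTENT =
INFINITE complexity only (two affinely dependent forms: the k-tuple translates n+h_1,…,n+h_k and
their fibrations; d = 1 translate face = upper prime k-tuples in Λ-form, all k); finite-complexity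
systems are the Green–Tao–Ziegler THEOREM — the AP face is not progress (critic N2). WEAKER than UQ
and than the uniform upper half (kernel: necessity fixedUpper_of_ghl; Goldbach-vacuity
fixed_holds_goldbachPair — (n, c−n) satisfies it trivially, so no binary content; Siegel-INERT:
fixed-shift HL holds near exceptional scales, MatomakiMerikoski2023_fixedShift / Heath-Brown 1983 /
Tao–Teräväinen, while USZ refutes the uniform half) — hence typed BARE (record T1 logic). Leaf
BARRIER head-on (target constant 1; Type-I sieve ceiling 2 even under EH: SelbergParity,
LinearSieveOptimality); FU is ⊠-closed, so a constan -/
@[route_item "route-Parity-SiegelSpectrumSplit"]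
def FixedUpper : Prop :=
  ∀ (d t : ℕ), 1 ≤ d → 1 ≤ t → ∀ Ψ : Fin t → Literature.NumberTheory.Sieve.AffLinForm d, Literature.NumberTheory.Sieve.IsNondegenerateSystem Ψ → ∀ ε : ℝ, 0 < ε → ∃ N₀ : ℕ, ∀ N : ℕ, N₀ ≤ N → ∀ K : Set (Fin d → ℝ), Convex ℝ K → K ⊆ Literature.NumberTheory.Sieve.realBox d N → Literature.NumberTheory.Sieve.vonMangoldtSum Ψ K N - Literature.NumberTheory.Sieve.archFactor Ψ K * Literature.NumberTheory.Sieve.singularProduct Ψ ≤ ε * (N : ℝ) ^ d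

-- parent: UpperGivenBoundedSiegel · child (gen 1)
/--     item stmt-Parity-26853 · crux · leaf INSTRUMENTABLE · rank 302 · open
    parent: UpperGivenBoundedSiegel · by planner
    why it might fail: It is the uniform-in-shift (binary Goldbach-type) upper bound with factor 1+ε given Q and all tuples: pointwise-in-h control beyond windows N^{8/33} (MRT 2019) is open; the circle method misses binary minor arcs by log x (CircleMethodBinary).
    sources: GreenTao2010, MatomakiRadziwillTao2019, MatomakiMerikoski2023, Literature.Barriers.Parity.TrueComplexityBinary, Literature.Barriers.Parity.CircleMethodBinary, Summits/Parity/GeneralizedHardyLittlewood/Theses/ShiftTauberian.lean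
[crux · DECLARED-RESIDUAL; node TupleUniformitySplit (lens-5 g3): shift-uniformity of the upper half
GIVEN bounded Siegel quality and the fixed-pattern upper half] Q → FixedUpper → (uniform upper half
of GHL: one N₀(d,t,L,ε) for all Ψ with ‖Ψ‖_N ≤ L). Exactly the binary / moving-target content of UQ
(Goldbach-type systems (n, N−n), shifts h ≍ N) with the tuple content split off: kernel
upperGivenBoundedSiegel_iff : UQ ↔ (Q → FixedUpper) ∧ this, so WEAKER than UQ (separating world ¬(Q
→ FixedUpper)) and the FixedUpper hypothesis is load-bearing (T6). Transpose of the PairsToGHL cut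
(9389: pairs-uniform base, tuples residual). INSTRUMENTABLE: kernel windowUpper_of_fixedUpper —
FixedUpper in dimension d+1 already gives every shift-WINDOW average of length ≫ εN; this item is
WINDOW(δN) → POINT; notches N^{8/33} (MRT) → N^{7/30} (ShiftTauberian) → polylog are rungs (T11),
not filed. -/
@[route_item "route-Parity-SiegelSpectrumSplit"]
def UniformUpperGivenFixed : Prop :=
  (∃ η₀ : ℝ, ∃ q₀ : ℕ, ∀ (q : ℕ) [NeZero q] (χ : DirichletCharacter ℂ q) (η : ℝ), q₀ ≤ q → Literature.Barriers.Parity.IsSiegelZero χ η → η < η₀) → (∀ (d t : ℕ), 1 ≤ d → 1 ≤ t → ∀ Ψ : Fin t → Literature.NumberTheory.Sieve.AffLinForm d, Literature.NumberTheory.Sieve.IsNondegenerateSystem Ψ → ∀ ε : ℝ, 0 < ε → ∃ N₀ : ℕ, ∀ N : ℕ, N₀ ≤ N → ∀ K : Set (Fin d → ℝ), Convex ℝ K → K ⊆ Literature.NumberTheory.Sieve.realBox d N → Literature.NumberTheory.Sieve.vonMangoldtSum Ψ K N - Literature.NumberTheory.Sieve.archFactor Ψ K * Literature.NumberTheory.Sieve.singularProduct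 Ψ ≤ ε * (N : ℝ) ^ d) → ∀ (d t L : ℕ), 1 ≤ d → 1 ≤ t → ∀ ε : ℝ, 0 < ε → ∃ N₀ : ℕ, ∀ N : ℕ, N₀ ≤ N → ∀ Ψ : Fin t → Literature.NumberTheory.Sieve.AffLinForm d, Literature.NumberTheory.Sieve.IsNondegenerateSystem Ψ → Literature.NumberTheory.Sieve.affLinSize Ψ N ≤ L → ∀ K : Set (Fin d → ℝ), Convex ℝ K → K ⊆ Literature.NumberTheory.Sieve.realBox d N → Literature.NumberTheory.Sieve.vonMangoldtSum Ψ K N - Literature.NumberTheory.Sieve.archFactor Ψ K * Literature.NumberTheory.Sieve.singularProduct Ψ ≤ ε * (N : ℝ) ^ d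

-- parent: UpperGivenBoundedSiegel · glue (gen 1)
/--     item stmt-Parity-26854 · support · rank 303 · closed · proved by Summit.Parity.GeneralizedHardyLittlewood.Theses.SiegelSpectrumSplit.upperGivenBoundedSiegelGlue_holds (prover)
    parent: UpperGivenBoundedSiegel · GLUE: children ⟹ parent · by planner
FixedUpper → UniformUpperGivenFixed → UpperGivenBoundedSiegel -/
@[route_item "route-Parity-SiegelSpectrumSplit"]
def UpperGivenBoundedSiegelGlue : Prop :=
  FixedUpper → UniformUpperGivenFixed → UpperGivenBoundedSiegel

-- `UpperGivenBoundedSiegelGlue` holds: proved by `Summit.Parity.GeneralizedHardyLittlewood.Theses.SiegelSpectrumSplit.upperGivenBoundedSiegelGlue_holds` (its module imports this route file, so no `_holds` link can be stated here).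

/-- item stmt-Parity-25150 · crux · RESIDUAL (gen 0; summit-strength until shown otherwise, D-0170) · rank 4 · SPLIT (gen 1) into FixedLower, UniformLowerGivenFixed + glue LowerGivenBoundedSiegelGlue · direct attempts still welcome (low priority) · by planner
why it might fail: as a TARGET it contains the twin prime conjecture with the right constant; every Type-I/II-information route to positive pair lower bounds is blocked by parity (Selberg, Bombieri, Ford–Maynard) even given Q; no idea on file produces primes in pairs.
sources: GreenTao2010, Bombieri1976, FordMaynard2024, FriedlanderIwaniec2022, HardyLittlewood1923
[crux] assuming bounded Siegel-zero quality, the LOWER half of shift-uniform GHL: same quantifier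
block, conclusion β_∞·∏β_p − Σ ≤ εN^d (DECLARED-RESIDUAL of the lower half, conditioned on Q;
STRICTLY weaker than the bare lower half: a proof of (this → LowerGHL) proves Landau–Siegel at
conductors 4 ∣ q, kernel strict_lower via the factor-0 family h = q/2). [deps:
BoundedSiegelZeroQuality] [difficulty: open-problem] ‖ TAG [crit-1 CLEARED 2026-08-30T01:46:27Z,
HOME/STATUS.md l.26; amendment A1 l.24]: WEAKER-formal + DECLARED-RESIDUAL(Q) of the LOWER half
(strictness certificate strict_lower: Landau–Siegel at 4 ∣ q; tribunal residual of this filing);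
leaf IDEA-NEEDED + BARRIER(PrimePairParity, FordMaynardPrimeSieves); rung TwinLowerDensity
stmt-Parity-18377 (LIVE route OneSidedAggregateExchangeRate; lens-4 child PPBG ∧ TwinShare). BC3
birth skeleton: stub_lowerDimOneQ (open) → stub_lowerFibration (provable-now) → LQ. Census
HOME/census/COSTUME-CENSUS-v1.md sha256
4afbbbc68c038369818dcc2bcc5990569ac50a4757d8938468c0838377ddd628 rows WK7, RG0. -/
@[route_item "route-Parity-SiegelSpectrumSplit"]
def LowerGivenBoundedSiegel : Prop :=
  (∃ η₀ : ℝ, ∃ q₀ : ℕ, ∀ (q : ℕ) [NeZero q] (χ : DirichletCharacter ℂ q) (η : ℝ), q₀ ≤ q → Literature.Barriers.Parity.IsSiegelZero χ η → η < η₀) → ∀ (d t L : ℕ), 1 ≤ d → 1 ≤ t → ∀ ε : ℝ, 0 < ε → ∃ N₀ : ℕ, ∀ N : ℕ, N₀ ≤ N → ∀ Ψ : Fin t → Literature.NumberTheory.Sieve.AffLinForm d, Literature.NumberTheory.Sieve.IsNondegenerateSystem Ψ → Literature.NumberTheory.Sieve.affLinSize Ψ N ≤ L → ∀ K : Set (Fin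 d → ℝ), Convex ℝ K → K ⊆ Literature.NumberTheory.Sieve.realBox d N → Literature.NumberTheory.Sieve.archFactor Ψ K * Literature.NumberTheory.Sieve.singularProduct Ψ - Literature.NumberTheory.Sieve.vonMangoldtSum Ψ K N ≤ ε * (N : ℝ) ^ d

-- parent: LowerGivenBoundedSiegel · child (gen 1)
/--     item stmt-Parity-26863 · crux · leaf BARRIER [Literature.Barriers.Parity.PrimePairParity] · rank 401 · open
    parent: LowerGivenBoundedSiegel · by planner
    why it might fail: As a target it contains twin primes and every prime k-tuple with the HL constant: parity (Selberg, Bombieri, Ford–Maynard; PrimePairParity even under GEH) blocks all Type-I/II routes; bounded gaps name no pattern.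
    sources: GreenTao2010, HardyLittlewood1923, HeathBrown1983PrimeTwins, TaoTeravainen2022SiegelZero, MatomakiMerikoski2023, Maynard2015SmallGaps
[crux; node TupleUniformitySplit (lens-5 g3, crit-1 CLEARED 2026-08-30T03:41:11Z STATUS l.116),
quantifier-order cut of LQ: the FIXED-PATTERN lower half] For every FIXED non-degenerate system Ψ
(all d, t; ∀Ψ ∃N₀) and ε > 0, eventually in N, uniformly in convex K ⊆ [−N,N]^d: β_∞(Ψ,K)·∏β_p(Ψ) −
Σ_{n∈K} ∏Λ(ψ_i(n)) ≤ εN^d. OPEN CONTENT = INFINITE complexity only (k-tuple translates and their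
fibrations: twin primes, prime triples, … with the Hardy–Littlewood constant); finite complexity =
Green–Tao–Ziegler theorem (critic N2). WEAKER than LQ and than the uniform lower half (kernel
fixedLower_of_ghl; fixed_holds_goldbachPair: binary Goldbach for large even N is NOT in it;
Siegel-INERT by MatomakiMerikoski2023_fixedShift / Heath-Brown 1983 / Tao–Teräväinen) — typed BARE.
Leaf IDEA-NEEDED + BARRIER head-on (PrimePairParity: no sieve-theoretic twin primes even under GEH;
SelbergParity); FL is ⊠-closed (no constant dial on FL, T10/N1); rung currency strictly below any
single named pattern: bounded gaps H₁ ≤ 246 (Maynard / Polymath8b; tree maynardTuple chain) = some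
fixed pair pattern has infinitely many prime points; TwinLowerDensity stmt-Parity-18377. -/
@[route_item "route-Parity-SiegelSpectrumSplit"]
def FixedLower : Prop :=
  ∀ (d t : ℕ), 1 ≤ d → 1 ≤ t → ∀ Ψ : Fin t → Literature.NumberTheory.Sieve.AffLinForm d, Literature.NumberTheory.Sieve.IsNondegenerateSystem Ψ → ∀ ε : ℝ, 0 < ε → ∃ N₀ : ℕ, ∀ N : ℕ, N₀ ≤ N → ∀ K : Set (Fin d → ℝ), Convex ℝ K → K ⊆ Literature.NumberTheory.Sieve.realBox d N → Literature.NumberTheory.Sieve.archFactor Ψ K * Literature.NumberTheory.Sieve.singularProduct Ψ - Literature.NumberTheory.Sieve.vonMangoldtSum Ψ K N ≤ ε * (N : ℝ) ^ d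

-- parent: LowerGivenBoundedSiegel · child (gen 1)
/--     item stmt-Parity-26864 · crux · leaf INSTRUMENTABLE · rank 402 · open
    parent: LowerGivenBoundedSiegel · by planner
    why it might fail: It contains binary Goldbach with the Hardy–Littlewood main term for every large even N, given Q and the tuples: no method controls an individual shift h ≍ N; almost-all-h results (MRT 2019, window N^{8/33}) are the ceiling.
    sources: GreenTao2010, HardyLittlewood1923, MatomakiRadziwillTao2019, MatomakiMerikoski2023, Literature.Barriers.Parity.CircleMethodBinary, Literature.Barriers.Parity.TrueComplexityBinary
[crux · DECLARED-RESIDUAL; node TupleUniformitySplit (lens-5 g3): shift-uniformity of the lower half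
GIVEN bounded Siegel quality and the fixed-pattern lower half] Q → FixedLower → (uniform lower half
of GHL). Exactly the binary content of LQ — binary Goldbach for all large even N with the HL main
term, and all moving-shift lower bounds — with the tuples split off: kernel
lowerGivenBoundedSiegel_iff : LQ ↔ (Q → FixedLower) ∧ this; WEAKER than LQ (world ¬(Q →
FixedLower)); FixedLower hypothesis load-bearing (T6). INSTRUMENTABLE: kernel
windowLower_of_fixedLower gives all shift windows ≫ εN from FixedLower_{d+1}; this item is
WINDOW(δN) → POINT; notch ladder = rungs (T11). -/
@[route_item "route-Parity-SiegelSpectrumSplit"]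
def UniformLowerGivenFixed : Prop :=
  (∃ η₀ : ℝ, ∃ q₀ : ℕ, ∀ (q : ℕ) [NeZero q] (χ : DirichletCharacter ℂ q) (η : ℝ), q₀ ≤ q → Literature.Barriers.Parity.IsSiegelZero χ η → η < η₀) → (∀ (d t : ℕ), 1 ≤ d → 1 ≤ t → ∀ Ψ : Fin t → Literature.NumberTheory.Sieve.AffLinForm d, Literature.NumberTheory.Sieve.IsNondegenerateSystem Ψ → ∀ ε : ℝ, 0 < ε → ∃ N₀ : ℕ, ∀ N : ℕ, N₀ ≤ N → ∀ K : Set (Fin d → ℝ), Convex ℝ K → K ⊆ Literature.NumberTheory.Sieve.realBox d N → Literature.NumberTheory.Sieve.archFactor Ψ K * Literature.NumberTheory.Sieve.singularProduct Ψ - Literature.NumberTheory.Sieve.vonMangoldtSum Ψ K N ≤ ε * (N : ℝ) ^ d) → ∀ (d t L : ℕ), 1 ≤ d → 1 ≤ t → ∀ ε : ℝ, 0 < ε → ∃ N₀ : ℕ, ∀ N : ℕ, N₀ ≤ N → ∀ Ψ : Fin t → Literature.NumberTheory.Sieve.AffLinForm d, Literature.NumberTheory.Sieve.IsNondegenerateSystem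 Ψ → Literature.NumberTheory.Sieve.affLinSize Ψ N ≤ L → ∀ K : Set (Fin d → ℝ), Convex ℝ K → K ⊆ Literature.NumberTheory.Sieve.realBox d N → Literature.NumberTheory.Sieve.archFactor Ψ K * Literature.NumberTheory.Sieve.singularProduct Ψ - Literature.NumberTheory.Sieve.vonMangoldtSum Ψ K N ≤ ε * (N : ℝ) ^ d

-- parent: LowerGivenBoundedSiegel · glue (gen 1)
/--     item stmt-Parity-26865 · support · rank 403 · closed · proved by Summit.Parity.GeneralizedHardyLittlewood.Theses.SiegelSpectrumSplit.lowerGivenBoundedSiegelGlue_holds (prover)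
    parent: LowerGivenBoundedSiegel · GLUE: children ⟹ parent · by planner
FixedLower → UniformLowerGivenFixed → LowerGivenBoundedSiegel -/
@[route_item "route-Parity-SiegelSpectrumSplit"]
def LowerGivenBoundedSiegelGlue : Prop :=
  FixedLower → UniformLowerGivenFixed → LowerGivenBoundedSiegel

-- `LowerGivenBoundedSiegelGlue` holds: proved by `Summit.Parity.GeneralizedHardyLittlewood.Theses.SiegelSpectrumSplit.lowerGivenBoundedSiegelGlue_holds` (its module imports this route file, so no `_holds` link can be stated here).

/-- item stmt-Parity-32327 · aside · rank 9 · open · by planner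
[aside] NECESSARY-CONSEQUENCE NOTCH beneath FixedLower (stmt-Parity-26863), catalogued per operator
ruling 2026-08-30T10:55Z (bookkeeping item under the existing leaf; support/aside, not crux; never
staffed, zero distance credit). «DecadeStep»: for every N there are CONSECUTIVE primes N ≤ p < q
with p ≡ 1, q ≡ 3 (mod 10) — the literal (10; 1, 3) instance of the Lemke Oliver–Soundararajan
consecutive-residue conjecture; FixedLower ⟹ DecadeStep via prime quadruplets (n, n+2, n+6, n+8), n
≡ 1 mod 10 (lens-3 g7 kernel ConsecutivePrimeWords.lean sha16 4ac097f5b63f2461,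
decadeStep_of_fixedLower; critic CLEARED row 79 as axis registration «residue words of consecutive
primes»). Why it might be out of reach: no specific non-constant residue word of consecutive primes
is known to occur infinitely often (Shiu 2000 gives constant words only; Maynard 2016 gives words
avoiding patterns, not prescribing consecutive ones). Sources: arXiv:2409.12819 p.3;
LemkeOliverSoundararajan2016 (PNAS 113); Shiu2000. -/
@[route_item "route-Parity-SiegelSpectrumSplit"]
def DecadeStep : Prop :=
  ∀ N : ℕ, ∃ p q : ℕ, N ≤ p ∧ p < q ∧ p.Prime ∧ q.Prime ∧ (∀ m : ℕ, p < m → m < q → ¬ m.Prime) ∧ p % 10 = 1 ∧ q % 10 = 3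

/-- item stmt-Parity-32337 · aside · rank 9 · open · by planner
[aside] NECESSARY-CONSEQUENCE NOTCH beneath FixedLower (stmt-Parity-26863), catalogued per operator
ruling 2026-08-30T10:55Z (bookkeeping item under the existing leaf; support/aside, not crux; never
staffed, zero distance credit). «EqualGapTriple»: for every N there are three CONSECUTIVE primes N ≤
p < q < r (q the only prime strictly between p and r) in arithmetic progression, q − p = r − q —
i.e. d_n = d_{n+1} infinitely often (Erdős–Turán 1948; Guy UPINT A6); FixedLower ⟹ EqualGapTriple
via the admissible sextuple (0, 6, 12, 16, 18, 22) restricted so the middle gaps are prime-free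
(lens-3 g7 kernel ConsecutivePrimeWords.lean sha16 4ac097f5b63f2461, equalGapTriple_of_fixedLower;
critic CLEARED row 79 as axis registration «gap words of consecutive primes»). The residual WordLift
(DecadeStep → EqualGapTriple → FixedLower) is ≡ FixedLower given the two words (T21 normal form) and
is deliberately NOT catalogued. Why it might be out of reach: equal consecutive gaps infinitely
often is open since Erdős–Turán 1948; Maynard–Tao / Banks–Freiberg–Maynard give limit points and
monotone runs of normalised gaps, never an exact equality of consecutive gaps. Sources: Guy1994 A6;
ErdosTuran1948; -/
@[route_item "route-Parity-SiegelSpectrumSplit"]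
def EqualGapTriple : Prop :=
  ∀ N : ℕ, ∃ p q r : ℕ, N ≤ p ∧ p < q ∧ q < r ∧ p.Prime ∧ q.Prime ∧ r.Prime ∧ (∀ m : ℕ, p < m → m < r → m.Prime → m = q) ∧ q - p = r - q

/-- item stmt-Parity-25151 · assembly · rank 1 · closed · proved by Summit.Parity.GeneralizedHardyLittlewood.Theses.SiegelSpectrumSplit.assembly_proof (prover) · by planner
sources: GreenTao2010, MatomakiMerikoski2023
[assembly] BoundedSiegelZeroQuality → UpperGivenBoundedSiegel → LowerGivenBoundedSiegel →
GeneralizedHardyLittlewood ‖ [writer] deciding theorem `closes` (glue.lean, 3 binders all consumed,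
N₀ := max, abs_sub_le_iff); exactness GHL ↔ Q ∧ UQ ∧ LQ mod MM2023 = lens-5 `node_iff`. -/
@[route_item "route-Parity-SiegelSpectrumSplit"]
def Assembly : Prop :=
  BoundedSiegelZeroQuality → UpperGivenBoundedSiegel → LowerGivenBoundedSiegel → GeneralizedHardyLittlewood

-- `Assembly` holds: proved by `Summit.Parity.GeneralizedHardyLittlewood.Theses.SiegelSpectrumSplit.assembly_proof` (its module imports this route file, so no `_holds` link can be stated here).

/-! D-0027 §2.1 — DECIDING THEOREM (planner-authored via `route open/edit --closes-file`; by planner-decomp-parity-writer-1-g0-0 2026-08-30T02:22:53Z):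
its hypotheses are this route's items and its conclusion the sub-problem Statement (glue_lint), and it elaborates with this file. -/

@[closes "route-Parity-SiegelSpectrumSplit"] theorem closes (hQ : BoundedSiegelZeroQuality) (hUQ : UpperGivenBoundedSiegel)
    (hLQ : LowerGivenBoundedSiegel) : GeneralizedHardyLittlewood := by
  intro d t L hd ht ε hε
  obtain ⟨N₁, h₁⟩ := hUQ hQ d t L hd ht ε hε
  obtain ⟨N₂, h₂⟩ := hLQ hQ d t L hd ht ε hε
  refine ⟨max N₁ N₂, fun N hN Ψ hΨ hΨL K hK hKN => abs_sub_le_iff.mpr ⟨?_, ?_⟩⟩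
  · exact h₁ N (le_trans (le_max_left _ _) hN) Ψ hΨ hΨL K hK hKN
  · exact h₂ N (le_trans (le_max_right _ _) hN) Ψ hΨ hΨL K hK hKN

end Summit.Parity.GeneralizedHardyLittlewood.Theses.SiegelSpectrumSplit
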